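import Literature.NumberTheory.LFunctions.DobnerLemma1Proofs
import Literature.Analysis.SpecialFunctions.GammaVerticalBounds
import Literature.Analysis.Complex.VerticalLineShift
import Mathlib.Analysis.MellinTransform
import Mathlib.Analysis.SpecialFunctions.Gamma.BohrMollerup
import Mathlib.MeasureTheory.Measure.Haar.NormedSpace
import Mathlib.MeasureTheory.Measure.Lebesgue.Integral
import HarnessLib

/-!
# Dobner's Lemma 2 (decay of the inverse Mellin transform of `∏ Γ(aⱼ w + bⱼ)`) — the discharge

RH-FREE literature proof. Trunk T-ANT (`Literature/NumberTheory/LFunctions`); companion of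
`DobnerSelbergClass.lean`, where `Literature.NumberTheory.LFunctions.dobner_lemma2` is the named
fact (A. Dobner, *A proof of Newman's conjecture for the extended Selberg class*, Acta Arith. 201
(2021) = arXiv:2005.05142, **Lemma 2**, p. 6; proof §5, pp. 15–16 of the held arXiv text): for
`aⱼ > 0`, `Re bⱼ ≥ 0` (`k ≥ 1`) and
`h(x) = (1/2πi) ∫_{(1)} ∏ⱼ Γ(aⱼ w + bⱼ) x^{−w} dw = mellinInv 1 (∏ⱼ Γ(aⱼ · + bⱼ)) x` there are
`δ > 0`, `C` with `|h(x)| ≤ C e^{−x^δ}` for all `x ≥ 1` (`dobner_lemma2_holds`).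

## Proof (a different road from the printed one; the STATEMENT is unchanged)

The source proves Lemma 2 through the class `𝓡` of functions with stretched-exponential decay,
its closure under multiplicative convolution, and the Mellin convolution theorem
(`h` = `k`-fold convolution of the inverse Mellin transforms `a⁻¹ x^{b/a} e^{−x^{1/a}}` of the
factors). Mathlib has no Mellin convolution theorem, so we take the classical contour-shift road
instead (same conclusion, explicit constants):

1. One factor (§`maj`): by the tree's Stirling bound for all real parts
   (`DobnerLemma1.abs_log_norm_Gamma_add_le`, from `DobnerLemma1Proofs.lean`) and
   `|Γ(x+iy)| ≤ Γ(x)` (`GammaVert.norm_Gamma_le_Gamma_re`), for `x > 0` and all `y`: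
   `|Γ(x+iy)| ≤ m_x(|y|)`, `m_x(t) = (Γ(x)e^{π/2} + e^{6x+5}(2x+2)^{3x+3} t^{3x+3}) e^{−πt/2}`,
   with `∫₀^∞ m_x = Γ(x)e^{π/2}(2/π) + K(x)(2/π)^{3x+4}Γ(3x+4)` (Euler integrals).
2. The product (§`Product`): `|Ψ(σ+iy)| ≤ ∏_{j≠j₀} Γ(xⱼ) · m_{x₀}(|a₀y + Im b₀|)`,
   `xⱼ = aⱼσ + Re bⱼ`, integrable in `y` with integral `M(σ)`; and
   `log M(c) ≤ A · c log c` for `c ≥ c₀ = 3 + ∑ 2/aⱼ` (`Γ(x) ≤ ⌈x⌉! ≤ (x+1)^{x+1}` via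
   `Real.Gamma_strictMonoOn_Ici`).
3. The shift (§`Shift`): `mellinInv 1 Ψ x = mellinInv c Ψ x` for `x, c ≥ 1`, by the tree's
   `Literature.Analysis.Complex.integral_vertical_eq_of_differentiableOn` (no poles of
   `Γ(aⱼ w + bⱼ)` on `Re w > 0`; horizontal decay uniform on `1 ≤ Re w ≤ c` from step 1 and a
   compactness bound for `Γ` on `[xⱼ(1), xⱼ(c)]`).
4. Assembly: `|h(x)| ≤ x^{−c} M(c) ≤ exp(−c log x + A c log c)`; with `δ = 1/(2A)` and
   `c = max(c₀, x^δ)` this is `≤ C e^{−x^δ}`, `C = exp(A c₀ log c₀ + c₀)`.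

bears_on: N-C/N-P (COLUMN 3 DBN). WHAT THIS IS NOT: an estimate for inverse Mellin transforms of
Gamma products; nothing here bears on the truth of RH.

## References

* A. Dobner, arXiv:2005.05142 = Acta Arith. 201 (2021): Lemma 2 (p. 6), its proof (§5,
  pp. 15–16).
* E. C. Titchmarsh, *The Theory of Functions*, §3.12 (shifting vertical lines of integration).
-/

noncomputable section

open Complex Filter Set MeasureTheory
open Literature.Analysis.SpecialFunctions

namespace Literature.NumberTheory.LFunctions

namespace DobnerLemma2

/-! ### One `Γ`-factor: an explicit integrable majorant on vertical lines -/

/-- The exponent `p(x) = 3x + 3`. [folklore] -/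
def pExp (x : ℝ) : ℝ := 3 * x + 3

/-- The constant `K(x) = e^{6x+5} (2x+2)^{3x+3}`. [folklore] -/
def kConst (x : ℝ) : ℝ := Real.exp (6 * x + 5) * (2 * x + 2) ^ pExp x

/-- The majorant `m_x(t) = (Γ(x) e^{π/2} + K(x) t^{p(x)}) e^{−πt/2}`. [folklore] -/
def maj (x t : ℝ) : ℝ :=
  (Real.Gamma x * Real.exp (Real.pi / 2) + kConst x * t ^ pExp x) * Real.exp (-(Real.pi / 2 * t))

/-- `p(x) > 0` for `x > 0`. [folklore] -/
private theorem pExp_pos {x : ℝ} (hx : 0 < x) : 0 < pExp x := by unfold pExp; linarith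

/-- `K(x) > 0` for `x > 0`. [folklore] -/
private theorem kConst_pos {x : ℝ} (hx : 0 < x) : 0 < kConst x := by
  unfold kConst
  exact mul_pos (Real.exp_pos _) (Real.rpow_pos_of_pos (by linarith) _)

/-- `m_x(t) ≥ 0` for `x > 0`, `t ≥ 0`. [folklore] -/
private theorem maj_nonneg {x : ℝ} (hx : 0 < x) {t : ℝ} (ht : 0 ≤ t) : 0 ≤ maj x t := by
  unfold maj
  have := Real.Gamma_pos_of_pos hx
  have := kConst_pos hx
  have : 0 ≤ t ^ pExp x := Real.rpow_nonneg ht _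
  positivity

/-- Decay bound for one factor: for `x > 0`, `|y| ≥ 1`,
`‖Γ(x + iy)‖ ≤ K(x) |y|^{p(x)} e^{−π|y|/2}`. [cite: Dobner2021, Lemma 2 (proof, pp. 15–16)] -/
theorem norm_Gamma_le_decay {x : ℝ} (hx : 0 < x) {y : ℝ} (hy : 1 ≤ |y|) :
    ‖Complex.Gamma ((x : ℂ) + y * I)‖ ≤ kConst x * |y| ^ pExp x * Real.exp (-(Real.pi / 2 * |y|)) := by
  set w : ℂ := (x : ℂ) + y * I with hw
  have hre : w.re = x := by simp [hw]
  have him : w.im = y := by simp [hw]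
  have hB := DobnerLemma1.abs_log_norm_Gamma_add_le (w := w) (by rw [him]; exact hy)
  rw [hre, him, abs_of_pos hx] at hB
  have hΓ0 : 0 < ‖Complex.Gamma w‖ :=
    norm_pos_iff.2 (Complex.Gamma_ne_zero_of_re_pos (by rw [hre]; exact hx))
  have hup : Real.log ‖Complex.Gamma w‖ ≤
      -(Real.pi / 2 * |y|) + (3 * x + 3) * Real.log (2 * x + 1 + |y|) + 6 * x + 5 := by
    have := (abs_le.1 hB).2; linarith
  -- `log (2x+1+|y|) ≤ log (2x+2) + log |y|`
  have hy0 : 0 < |y| := by linarith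
  have hlog : Real.log (2 * x + 1 + |y|) ≤ Real.log (2 * x + 2) + Real.log |y| := by
    rw [← Real.log_mul (by linarith) hy0.ne']
    apply Real.log_le_log (by linarith)
    nlinarith
  have hup' : Real.log ‖Complex.Gamma w‖ ≤
      -(Real.pi / 2 * |y|) + (3 * x + 3) * Real.log (2 * x + 2) + (3 * x + 3) * Real.log |y| +
        (6 * x + 5) := by
    have h33 : 0 ≤ 3 * x + 3 := by linarith
    nlinarith
  calc ‖Complex.Gamma w‖ = Real.exp (Real.log ‖Complex.Gamma w‖) := (Real.exp_log hΓ0).symm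
    _ ≤ Real.exp (-(Real.pi / 2 * |y|) + (3 * x + 3) * Real.log (2 * x + 2) +
          (3 * x + 3) * Real.log |y| + (6 * x + 5)) := Real.exp_le_exp.2 hup'
    _ = kConst x * |y| ^ pExp x * Real.exp (-(Real.pi / 2 * |y|)) := by
        rw [kConst, pExp, Real.rpow_def_of_pos (by linarith : (0 : ℝ) < 2 * x + 2),
          Real.rpow_def_of_pos hy0, ← Real.exp_add, ← Real.exp_add, ← Real.exp_add]
        congr 1; ring

/-- The majorant bound for one factor, all `y`: for `x > 0`, `‖Γ(x + iy)‖ ≤ m_x(|y|)`. [cite: Dobner2021, Lemma 2 (proof, pp. 15–16)] -/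
theorem norm_Gamma_le_maj {x : ℝ} (hx : 0 < x) (y : ℝ) :
    ‖Complex.Gamma ((x : ℂ) + y * I)‖ ≤ maj x |y| := by
  have hΓx : 0 < Real.Gamma x := Real.Gamma_pos_of_pos hx
  have hK : 0 < kConst x := kConst_pos hx
  have hyp : 0 ≤ |y| ^ pExp x := Real.rpow_nonneg (abs_nonneg y) _
  have hexp : 0 < Real.exp (-(Real.pi / 2 * |y|)) := Real.exp_pos _
  rcases le_or_gt 1 |y| with hy | hy
  · -- `|y| ≥ 1`: decay bound
    calc ‖Complex.Gamma ((x : ℂ) + y * I)‖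
        ≤ kConst x * |y| ^ pExp x * Real.exp (-(Real.pi / 2 * |y|)) := norm_Gamma_le_decay hx hy
      _ ≤ maj x |y| := by
          unfold maj
          have : 0 ≤ Real.Gamma x * Real.exp (Real.pi / 2) * Real.exp (-(Real.pi / 2 * |y|)) := by
            positivity
          nlinarith
  · -- `|y| < 1`: `‖Γ‖ ≤ Γ(x) ≤ Γ(x) e^{π/2} e^{−π|y|/2}`
    have h1 : ‖Complex.Gamma ((x : ℂ) + y * I)‖ ≤ Real.Gamma x := GammaVert.norm_Gamma_le_Gamma_re hx y
    have h2 : 1 ≤ Real.exp (Real.pi / 2) * Real.exp (-(Real.pi / 2 * |y|)) := by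
      rw [← Real.exp_add]
      apply Real.one_le_exp
      nlinarith [Real.pi_pos, abs_nonneg y]
    calc ‖Complex.Gamma ((x : ℂ) + y * I)‖ ≤ Real.Gamma x * 1 := by rw [mul_one]; exact h1
      _ ≤ Real.Gamma x * (Real.exp (Real.pi / 2) * Real.exp (-(Real.pi / 2 * |y|))) :=
          mul_le_mul_of_nonneg_left h2 hΓx.le
      _ ≤ maj x |y| := by
          unfold maj
          have : 0 ≤ kConst x * |y| ^ pExp x * Real.exp (-(Real.pi / 2 * |y|)) := by positivity
          nlinarith

/-- The integral of the majorant over `(0, ∞)`: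
`∫₀^∞ m_x(t) dt = Γ(x) e^{π/2} (2/π) + K(x) (2/π)^{p+1} Γ(p+1)`. [folklore] -/
def majIntegral (x : ℝ) : ℝ :=
  Real.Gamma x * Real.exp (Real.pi / 2) * (2 / Real.pi) +
    kConst x * ((2 / Real.pi) ^ (pExp x + 1) * Real.Gamma (pExp x + 1))

/-- `∫₀^∞ m_x > 0`. [folklore] -/
private theorem majIntegral_pos {x : ℝ} (hx : 0 < x) : 0 < majIntegral x := by
  unfold majIntegral
  have := Real.Gamma_pos_of_pos hx
  have := kConst_pos hx
  have := Real.Gamma_pos_of_pos (by linarith [pExp_pos hx] : 0 < pExp x + 1)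
  have : 0 < (2 / Real.pi) ^ (pExp x + 1) := Real.rpow_pos_of_pos (by positivity) _
  positivity

/-- `∫₀^∞ m_x(t) dt = majIntegral x` (Euler integrals `∫₀^∞ t^{a−1} e^{−rt} dt = Γ(a)/r^a`). [cite: Dobner2021, Lemma 2 (proof, pp. 15–16)] -/
theorem integral_maj_Ioi {x : ℝ} (hx : 0 < x) : ∫ t in Ioi (0 : ℝ), maj x t = majIntegral x := by
  have hr : (0 : ℝ) < Real.pi / 2 := by positivity
  have hp1 : 0 < pExp x + 1 := by linarith [pExp_pos hx]
  -- the two pieces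
  have h1 : ∫ t in Ioi (0 : ℝ), t ^ ((1 : ℝ) - 1) * Real.exp (-(Real.pi / 2 * t)) =
      (1 / (Real.pi / 2)) ^ (1 : ℝ) * Real.Gamma 1 :=
    Real.integral_rpow_mul_exp_neg_mul_Ioi one_pos hr
  have h2 : ∫ t in Ioi (0 : ℝ), t ^ (pExp x + 1 - 1) * Real.exp (-(Real.pi / 2 * t)) =
      (1 / (Real.pi / 2)) ^ (pExp x + 1) * Real.Gamma (pExp x + 1) :=
    Real.integral_rpow_mul_exp_neg_mul_Ioi hp1 hr
  simp only [sub_self, Real.rpow_zero, one_mul, Real.rpow_one, Real.Gamma_one, mul_one] at h1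
  rw [add_sub_cancel_right] at h2
  have hdiv : 1 / (Real.pi / 2) = 2 / Real.pi := by field_simp
  rw [hdiv] at h1 h2
  -- integrability of the pieces (their integrals are non-zero)
  have hi1 : Integrable (fun t : ℝ ↦ Real.exp (-(Real.pi / 2 * t))) (volume.restrict (Ioi 0)) := by
    by_contra h
    have := integral_undef h
    rw [this] at h1
    exact absurd h1.symm (by positivity)
  have hi2 : Integrable (fun t : ℝ ↦ t ^ pExp x * Real.exp (-(Real.pi / 2 * t)))
      (volume.restrict (Ioi 0)) := by
    by_contra h
    have := integral_undef h
    rw [this] at h2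
    have : 0 < (2 / Real.pi) ^ (pExp x + 1) * Real.Gamma (pExp x + 1) :=
      mul_pos (Real.rpow_pos_of_pos (by positivity) _) (Real.Gamma_pos_of_pos hp1)
    linarith
  have hsplit : (fun t : ℝ ↦ maj x t) = fun t ↦
      Real.Gamma x * Real.exp (Real.pi / 2) * Real.exp (-(Real.pi / 2 * t)) +
        kConst x * (t ^ pExp x * Real.exp (-(Real.pi / 2 * t))) := by
    funext t; unfold maj; ring
  rw [hsplit, integral_add (hi1.const_mul _) (hi2.const_mul _), integral_const_mul,
    integral_const_mul, h1, h2, majIntegral]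

/-- The majorant is integrable on `(0, ∞)`. [folklore] -/
private theorem integrableOn_maj {x : ℝ} (hx : 0 < x) : IntegrableOn (fun t ↦ maj x t) (Ioi 0) := by
  by_contra h
  have h0 := integral_undef h
  rw [integral_maj_Ioi hx] at h0
  exact absurd h0 (majIntegral_pos hx).ne'

/-- `∫_ℝ m_x(|a y + β|) dy = (2/a) ∫₀^∞ m_x` for `a > 0`. [cite: Dobner2021, Lemma 2 (proof, pp. 15–16)] -/
theorem integral_maj_comp {x : ℝ} (hx : 0 < x) {a : ℝ} (ha : 0 < a) (β : ℝ) :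
    ∫ y : ℝ, maj x |a * y + β| = 2 / a * majIntegral x := by
  have h1 : (fun y : ℝ ↦ maj x |a * y + β|) = fun y ↦ (fun u ↦ maj x |a * u|) (y + β / a) := by
    funext y; congr 2; field_simp
  rw [h1, integral_add_right_eq_self (fun u ↦ maj x |a * u|) (β / a)]
  rw [MeasureTheory.Measure.integral_comp_mul_left (fun v ↦ maj x |v|) a, integral_comp_abs,
    integral_maj_Ioi hx, smul_eq_mul, abs_of_pos (inv_pos.2 ha)]
  ring

/-- `y ↦ m_x(|a y + β|)` is integrable over `ℝ`. [cite: Dobner2021, Lemma 2 (proof, pp. 15–16)] -/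
theorem integrable_maj_comp {x : ℝ} (hx : 0 < x) {a : ℝ} (ha : 0 < a) (β : ℝ) :
    Integrable fun y : ℝ ↦ maj x |a * y + β| := by
  by_contra h
  have h0 := integral_undef h
  rw [integral_maj_comp hx ha β] at h0
  have : 0 < 2 / a * majIntegral x := by have := majIntegral_pos hx; positivity
  linarith


/-! ### Growth bookkeeping: everything is `O(c log c)` -/

/-- `B(λ) = λ (|log λ| + 1)`. [folklore] -/
def bCoef (l : ℝ) : ℝ := l * (|Real.log l| + 1)

/-- `B(λ) ≥ 0` for `λ ≥ 0`. [folklore] -/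
private theorem bCoef_nonneg {l : ℝ} (hl : 0 ≤ l) : 0 ≤ bCoef l := by unfold bCoef; positivity

/-- `1 ≤ log c` for `c ≥ 3`. [folklore] -/
private theorem one_le_log_three_le {c : ℝ} (hc : 3 ≤ c) : 1 ≤ Real.log c := by
  rw [Real.le_log_iff_exp_le (by linarith)]
  have := Real.exp_one_lt_d9
  linarith

/-- `3 ≤ c log c` for `c ≥ 3`. [folklore] -/
private theorem three_le_mul_log {c : ℝ} (hc : 3 ≤ c) : 3 ≤ c * Real.log c := by
  have := one_le_log_three_le hc
  nlinarith

/-- `u log u ≤ B(λ) · c log c` when `1 ≤ u ≤ λ c`, `c ≥ 3`. [folklore] -/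
private theorem mul_log_le {c u l : ℝ} (hc : 3 ≤ c) (hu : 1 ≤ u) (hul : u ≤ l * c) :
    u * Real.log u ≤ bCoef l * (c * Real.log c) := by
  have hc0 : 0 < c := by linarith
  have hl : 0 < l := by
    by_contra h
    push Not at h
    have : l * c ≤ 0 := mul_nonpos_of_nonpos_of_nonneg h hc0.le
    linarith
  have hlogc : 1 ≤ Real.log c := one_le_log_three_le hc
  have hlogu : 0 ≤ Real.log u := Real.log_nonneg hu
  have h1 : Real.log u ≤ Real.log l + Real.log c := by
    rw [← Real.log_mul hl.ne' hc0.ne']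
    exact Real.log_le_log (by linarith) hul
  have h2 : Real.log l ≤ |Real.log l| := le_abs_self _
  have h3 : 0 ≤ |Real.log l| := abs_nonneg _
  calc u * Real.log u ≤ u * (|Real.log l| + Real.log c) := by
        apply mul_le_mul_of_nonneg_left _ (by linarith); linarith
    _ ≤ l * c * (|Real.log l| + Real.log c) := by
        apply mul_le_mul_of_nonneg_right hul; linarith
    _ = l * c * |Real.log l| + l * (c * Real.log c) := by ring
    _ ≤ l * c * |Real.log l| * Real.log c + l * (c * Real.log c) := by
        have : l * c * |Real.log l| * 1 ≤ l * c * |Real.log l| * Real.log c :=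
          mul_le_mul_of_nonneg_left hlogc (by positivity)
        linarith
    _ = bCoef l * (c * Real.log c) := by unfold bCoef; ring

/-- Linear terms: `α c + β ≤ (α + |β|) · c log c` for `c ≥ 3`, `α ≥ 0`. [folklore] -/
private theorem lin_le {c α β : ℝ} (hc : 3 ≤ c) (hα : 0 ≤ α) : α * c + β ≤ (α + |β|) * (c * Real.log c) := by
  have hlogc : 1 ≤ Real.log c := one_le_log_three_le hc
  have h3 := three_le_mul_log hc
  have h1 : α * c ≤ α * (c * Real.log c) := by
    have : α * c * 1 ≤ α * c * Real.log c := mul_le_mul_of_nonneg_left hlogc (by positivity)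
    linarith
  have h2 : β ≤ |β| * (c * Real.log c) := by
    have := le_abs_self β
    have : |β| * 1 ≤ |β| * (c * Real.log c) := mul_le_mul_of_nonneg_left (by linarith) (abs_nonneg _)
    linarith
  linarith

/-- `log Γ(x) ≤ (x + 1) log (x + 1)` for `x ≥ 2`. [folklore] -/
private theorem log_Gamma_le {x : ℝ} (hx : 2 ≤ x) :
    Real.log (Real.Gamma x) ≤ (x + 1) * Real.log (x + 1) := by
  set n : ℕ := ⌈x⌉₊ with hn
  have hxn : x ≤ n := Nat.le_ceil x
  have hnx : (n : ℝ) < x + 1 := Nat.ceil_lt_add_one (by linarith)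
  have hΓle : Real.Gamma x ≤ Real.Gamma ((n : ℝ) + 1) := by
    rcases eq_or_lt_of_le (show x ≤ (n : ℝ) + 1 by linarith) with h | h
    · rw [h]
    · exact (Real.Gamma_strictMonoOn_Ici (show (2 : ℝ) ≤ x from hx)
        (show (2 : ℝ) ≤ (n : ℝ) + 1 by linarith) h).le
  have hfact : Real.Gamma ((n : ℝ) + 1) = (n.factorial : ℝ) := Real.Gamma_nat_eq_factorial n
  have hnn : (n.factorial : ℝ) ≤ (n : ℝ) ^ n := by exact_mod_cast Nat.factorial_le_pow n
  have hx1 : 1 ≤ x + 1 := by linarith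
  have hpow : (n : ℝ) ^ n ≤ (x + 1) ^ (x + 1) := by
    calc (n : ℝ) ^ n ≤ (x + 1) ^ n := pow_le_pow_left₀ (Nat.cast_nonneg n) hnx.le n
      _ = (x + 1) ^ ((n : ℕ) : ℝ) := (Real.rpow_natCast _ _).symm
      _ ≤ (x + 1) ^ (x + 1) := Real.rpow_le_rpow_of_exponent_le hx1 hnx.le
  have hΓpos : 0 < Real.Gamma x := Real.Gamma_pos_of_pos (by linarith)
  calc Real.log (Real.Gamma x) ≤ Real.log ((x + 1) ^ (x + 1)) :=
        Real.log_le_log hΓpos (hΓle.trans (hfact ▸ hnn.trans hpow))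
    _ = (x + 1) * Real.log (x + 1) := Real.log_rpow (by linarith) _

/-- `1 ≤ Γ(x)` for `x ≥ 2`. [folklore] -/
private theorem one_le_Gamma {x : ℝ} (hx : 2 ≤ x) : 1 ≤ Real.Gamma x := by
  rcases eq_or_lt_of_le hx with h | h
  · rw [← h, Real.Gamma_two]
  · have := Real.Gamma_strictMonoOn_Ici (show (2 : ℝ) ≤ 2 from le_rfl) hx h
    rw [Real.Gamma_two] at this
    exact this.le

/-- `log(A + B) ≤ 1 + log A + log B` for `A, B ≥ 1`. [folklore] -/
private theorem log_add_le {A B : ℝ} (hA : 1 ≤ A) (hB : 1 ≤ B) :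
    Real.log (A + B) ≤ 1 + Real.log A + Real.log B := by
  have h : A + B ≤ 2 * (A * B) := by nlinarith
  have hlog2 : Real.log 2 ≤ 1 := by
    have := Real.log_le_sub_one_of_pos (by norm_num : (0:ℝ) < 2); linarith
  calc Real.log (A + B) ≤ Real.log (2 * (A * B)) := Real.log_le_log (by linarith) h
    _ = Real.log 2 + Real.log A + Real.log B := by
        rw [Real.log_mul (by norm_num) (by positivity), Real.log_mul (by positivity) (by positivity)]
        ring
    _ ≤ 1 + Real.log A + Real.log B := by linarith

/-- Growth of `log majIntegral`: for `x ≥ 2`,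
`log majIntegral x ≤ 3 + (x+1) log(x+1) + (6x+5) + (3/2)(2x+2) log(2x+2) + (3x+5) log(3x+5)`. [cite: Dobner2021, Lemma 2 (proof, pp. 15–16)] -/
theorem log_majIntegral_le {x : ℝ} (hx : 2 ≤ x) :
    Real.log (majIntegral x) ≤ 3 + (x + 1) * Real.log (x + 1) + (6 * x + 5) +
      3 / 2 * ((2 * x + 2) * Real.log (2 * x + 2)) + (3 * x + 5) * Real.log (3 * x + 5) := by
  have hx0 : 0 < x := by linarith
  have hp : pExp x = 3 * x + 3 := rfl
  have hp2 : 2 ≤ pExp x + 1 := by rw [hp]; linarith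
  have hΓ1 : 1 ≤ Real.Gamma x := one_le_Gamma hx
  have hΓp1 : 1 ≤ Real.Gamma (pExp x + 1) := one_le_Gamma hp2
  have hK1 : 1 ≤ kConst x := by
    unfold kConst
    have h1 : 1 ≤ Real.exp (6 * x + 5) := Real.one_le_exp (by linarith)
    have h2 : 1 ≤ (2 * x + 2) ^ pExp x := Real.one_le_rpow (by linarith) (by rw [hp]; linarith)
    nlinarith
  have hpi1 : 2 / Real.pi ≤ 1 := by
    rw [div_le_one Real.pi_pos]; linarith [Real.pi_gt_three]
  have hpi0 : 0 < 2 / Real.pi := by positivity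
  -- `majIntegral ≤ A' + B'` with `A' = Γ(x) e^{π/2}`, `B' = K Γ(p+1)`
  have hle : majIntegral x ≤ Real.Gamma x * Real.exp (Real.pi / 2) + kConst x * Real.Gamma (pExp x + 1) := by
    unfold majIntegral
    have h1 : Real.Gamma x * Real.exp (Real.pi / 2) * (2 / Real.pi) ≤
        Real.Gamma x * Real.exp (Real.pi / 2) * 1 := by
      apply mul_le_mul_of_nonneg_left hpi1; positivity
    have h2 : (2 / Real.pi) ^ (pExp x + 1) ≤ 1 := Real.rpow_le_one hpi0.le hpi1 (by linarith)
    have h3 : kConst x * ((2 / Real.pi) ^ (pExp x + 1) * Real.Gamma (pExp x + 1)) ≤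
        kConst x * (1 * Real.Gamma (pExp x + 1)) := by
      apply mul_le_mul_of_nonneg_left _ (by linarith)
      exact mul_le_mul_of_nonneg_right h2 (by linarith)
    linarith
  have hA1 : 1 ≤ Real.Gamma x * Real.exp (Real.pi / 2) := by
    have : 1 ≤ Real.exp (Real.pi / 2) := Real.one_le_exp (by positivity)
    nlinarith
  have hB1 : 1 ≤ kConst x * Real.Gamma (pExp x + 1) := by nlinarith
  have hpos : 0 < majIntegral x := majIntegral_pos hx0
  calc Real.log (majIntegral x)
      ≤ Real.log (Real.Gamma x * Real.exp (Real.pi / 2) + kConst x * Real.Gamma (pExp x + 1)) :=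
        Real.log_le_log hpos hle
    _ ≤ 1 + Real.log (Real.Gamma x * Real.exp (Real.pi / 2)) +
          Real.log (kConst x * Real.Gamma (pExp x + 1)) := log_add_le hA1 hB1
    _ = 1 + (Real.log (Real.Gamma x) + Real.pi / 2) +
          ((6 * x + 5) + pExp x * Real.log (2 * x + 2) + Real.log (Real.Gamma (pExp x + 1))) := by
        rw [Real.log_mul (by positivity) (by positivity), Real.log_exp, kConst,
          Real.log_mul (by positivity) (by positivity),
          Real.log_mul (by positivity) (Real.rpow_pos_of_pos (by linarith) _).ne', Real.log_exp,
          Real.log_rpow (by linarith)]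
    _ ≤ 3 + (x + 1) * Real.log (x + 1) + (6 * x + 5) +
          3 / 2 * ((2 * x + 2) * Real.log (2 * x + 2)) + (3 * x + 5) * Real.log (3 * x + 5) := by
        have h1 := log_Gamma_le hx
        have h2 := log_Gamma_le hp2
        rw [hp] at h2 ⊢
        have h3 : (3 * x + 3) * Real.log (2 * x + 2) = 3 / 2 * ((2 * x + 2) * Real.log (2 * x + 2)) := by
          ring
        have h4 : (3 * x + 3 + 1 + 1) = 3 * x + 5 := by ring
        rw [h4] at h2
        have hπ : Real.pi / 2 < 2 := by linarith [Real.pi_lt_four]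
        linarith


/-! ### The product `Ψ(w) = ∏ Γ(aⱼ w + bⱼ)`: majorant on vertical lines and its growth -/

section Product

variable {k : ℕ} (a : Fin k → ℝ) (b : Fin k → ℂ)

/-- `Ψ(w) = ∏ⱼ Γ(aⱼ w + bⱼ)`. [cite: Dobner2021, Lemma 2 (proof, pp. 15–16)] -/
def Psi (w : ℂ) : ℂ := ∏ j, Complex.Gamma ((a j : ℂ) * w + b j)

/-- The real parts `xⱼ(σ) = aⱼ σ + Re bⱼ` of the arguments on the line `Re w = σ`. [folklore] -/
def xRe (σ : ℝ) (j : Fin k) : ℝ := a j * σ + (b j).re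

/-- `aⱼ(σ + iy) + bⱼ = xⱼ(σ) + i(aⱼ y + Im bⱼ)`. [folklore] -/
private theorem arg_eq (σ y : ℝ) (j : Fin k) :
    (a j : ℂ) * ((σ : ℂ) + y * I) + b j =
      ((xRe a b σ j : ℝ) : ℂ) + ((a j * y + (b j).im : ℝ) : ℂ) * I := by
  apply Complex.ext <;> simp [xRe]

variable {a b}

/-- `xⱼ(σ) > 0` for `σ > 0`. [folklore] -/
private theorem xRe_pos (ha : ∀ j, 0 < a j) (hb : ∀ j, 0 ≤ (b j).re) {σ : ℝ} (hσ : 0 < σ) (j : Fin k) :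
    0 < xRe a b σ j := by
  unfold xRe; have := ha j; have := hb j; positivity

/-- The majorant of `‖Ψ(σ + iy)‖`: all factors but `j₀` by `Γ(Re)`, the factor `j₀` by `m`. [folklore] -/
def bigMaj (j₀ : Fin k) (σ y : ℝ) : ℝ :=
  (∏ j ∈ Finset.univ.erase j₀, Real.Gamma (xRe a b σ j)) *
    maj (xRe a b σ j₀) |a j₀ * y + (b j₀).im|

/-- Its integral over `ℝ`, `M(σ)`. [folklore] -/
def bigM (j₀ : Fin k) (σ : ℝ) : ℝ :=
  (∏ j ∈ Finset.univ.erase j₀, Real.Gamma (xRe a b σ j)) * (2 / a j₀ * majIntegral (xRe a b σ j₀))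

/-- The majorant: `‖Ψ(σ + iy)‖ ≤ bigMaj j₀ σ y` (`|Γ(x+iy)| ≤ Γ(x)` for `j ≠ j₀`, Stirling for `j₀`). [cite: Dobner2021, Lemma 2 (proof, pp. 15–16)] -/
theorem norm_Psi_le (ha : ∀ j, 0 < a j) (hb : ∀ j, 0 ≤ (b j).re) (j₀ : Fin k) {σ : ℝ}
    (hσ : 0 < σ) (y : ℝ) : ‖Psi a b ((σ : ℂ) + y * I)‖ ≤ bigMaj (a := a) (b := b) j₀ σ y := by
  unfold Psi bigMaj
  rw [norm_prod, ← Finset.mul_prod_erase Finset.univ _ (Finset.mem_univ j₀), mul_comm]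
  have hx := xRe_pos ha hb hσ
  apply mul_le_mul
  · refine Finset.prod_le_prod (fun j _ ↦ norm_nonneg _) fun j _ ↦ ?_
    rw [arg_eq]
    exact GammaVert.norm_Gamma_le_Gamma_re (hx j) _
  · rw [arg_eq]
    exact norm_Gamma_le_maj (hx j₀) _
  · exact norm_nonneg _
  · exact Finset.prod_nonneg fun j _ ↦ (Real.Gamma_pos_of_pos (hx j)).le

/-- `∫_ℝ bigMaj j₀ σ y dy = M(σ)`. [cite: Dobner2021, Lemma 2 (proof, pp. 15–16)] -/
theorem integral_bigMaj (ha : ∀ j, 0 < a j) (hb : ∀ j, 0 ≤ (b j).re) (j₀ : Fin k) {σ : ℝ}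
    (hσ : 0 < σ) : ∫ y : ℝ, bigMaj (a := a) (b := b) j₀ σ y = bigM (a := a) (b := b) j₀ σ := by
  unfold bigMaj bigM
  rw [integral_const_mul, integral_maj_comp (xRe_pos ha hb hσ j₀) (ha j₀)]

/-- The majorant is integrable over `ℝ`. [cite: Dobner2021, Lemma 2 (proof, pp. 15–16)] -/
theorem integrable_bigMaj (ha : ∀ j, 0 < a j) (hb : ∀ j, 0 ≤ (b j).re) (j₀ : Fin k) {σ : ℝ}
    (hσ : 0 < σ) : Integrable fun y : ℝ ↦ bigMaj (a := a) (b := b) j₀ σ y := by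
  unfold bigMaj
  exact (integrable_maj_comp (xRe_pos ha hb hσ j₀) (ha j₀) _).const_mul _

/-- `M(σ) > 0`. [folklore] -/
private theorem bigM_pos (ha : ∀ j, 0 < a j) (hb : ∀ j, 0 ≤ (b j).re) (j₀ : Fin k) {σ : ℝ}
    (hσ : 0 < σ) : 0 < bigM (a := a) (b := b) j₀ σ := by
  unfold bigM
  have hx := xRe_pos ha hb hσ
  have h1 : 0 < ∏ j ∈ Finset.univ.erase j₀, Real.Gamma (xRe a b σ j) :=
    Finset.prod_pos fun j _ ↦ Real.Gamma_pos_of_pos (hx j)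
  have := majIntegral_pos (hx j₀)
  have := ha j₀
  positivity

/-- The threshold `c₀ = 3 + ∑ⱼ 2/aⱼ`: for `c ≥ c₀` all `xⱼ(c) ≥ 2`. [folklore] -/
def cZero (a : Fin k → ℝ) : ℝ := 3 + ∑ j, 2 / a j

/-- `c₀ ≥ 3`. [folklore] -/
private theorem three_le_cZero (ha : ∀ j, 0 < a j) : 3 ≤ cZero a := by
  unfold cZero
  have : 0 ≤ ∑ j, 2 / a j := Finset.sum_nonneg fun j _ ↦ (div_pos two_pos (ha j)).le
  linarith

/-- `xⱼ(c) ≥ 2` for `c ≥ c₀`. [folklore] -/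
private theorem two_le_xRe (ha : ∀ j, 0 < a j) (hb : ∀ j, 0 ≤ (b j).re) {c : ℝ} (hc : cZero a ≤ c)
    (j : Fin k) : 2 ≤ xRe a b c j := by
  unfold xRe
  have h1 : 2 / a j ≤ ∑ i, 2 / a i :=
    Finset.single_le_sum (fun i _ ↦ (div_pos two_pos (ha i)).le) (Finset.mem_univ j)
  have h2 : 2 / a j ≤ c := by unfold cZero at hc; linarith
  have h3 : 2 ≤ a j * c := by
    have := (div_le_iff₀ (ha j)).1 h2; linarith
  linarith [hb j]

/-- The growth coefficient `A`. [folklore] -/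
def aCoef (a : Fin k → ℝ) (b : Fin k → ℂ) (j₀ : Fin k) : ℝ :=
  (∑ j ∈ Finset.univ.erase j₀, bCoef (a j + |(b j).re| + 1)) + |Real.log (2 / a j₀)| + 1 +
    bCoef (a j₀ + |(b j₀).re| + 1) + (6 * a j₀ + |6 * (b j₀).re + 5|) +
    3 / 2 * bCoef (2 * a j₀ + 2 * |(b j₀).re| + 2) + bCoef (3 * a j₀ + 3 * |(b j₀).re| + 5)

/-- `A > 0`. [folklore] -/
private theorem aCoef_pos (ha : ∀ j, 0 < a j) (j₀ : Fin k) : 0 < aCoef a b j₀ := by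
  unfold aCoef
  have h1 : 0 ≤ ∑ j ∈ Finset.univ.erase j₀, bCoef (a j + |(b j).re| + 1) :=
    Finset.sum_nonneg fun j _ ↦ bCoef_nonneg (by have := ha j; positivity)
  have h2 := bCoef_nonneg (show 0 ≤ a j₀ + |(b j₀).re| + 1 by have := ha j₀; positivity)
  have h3 := bCoef_nonneg (show 0 ≤ 2 * a j₀ + 2 * |(b j₀).re| + 2 by have := ha j₀; positivity)
  have h4 := bCoef_nonneg (show 0 ≤ 3 * a j₀ + 3 * |(b j₀).re| + 5 by have := ha j₀; positivity)
  have := ha j₀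
  positivity

/-- **Growth**: `log M(c) ≤ A · c log c` for `c ≥ c₀`. [cite: Dobner2021, Lemma 2 (proof, pp. 15–16)] -/
theorem log_bigM_le (ha : ∀ j, 0 < a j) (hb : ∀ j, 0 ≤ (b j).re) (j₀ : Fin k) {c : ℝ}
    (hc : cZero a ≤ c) :
    Real.log (bigM (a := a) (b := b) j₀ c) ≤ aCoef a b j₀ * (c * Real.log c) := by
  have hc3 : 3 ≤ c := (three_le_cZero ha).trans hc
  have hc0 : 0 < c := by linarith
  have hc1 : 1 ≤ c := by linarith
  have hx2 := two_le_xRe ha hb hc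
  have hx0 : ∀ j, 0 < xRe a b c j := fun j ↦ by linarith [hx2 j]
  set L : ℝ := c * Real.log c with hL
  have hL3 : 3 ≤ L := three_le_mul_log hc3
  -- each `log Γ(xⱼ)`
  have hΓj : ∀ j, Real.log (Real.Gamma (xRe a b c j)) ≤ bCoef (a j + |(b j).re| + 1) * L := by
    intro j
    refine (log_Gamma_le (hx2 j)).trans (mul_log_le hc3 (by linarith [hx2 j]) ?_)
    unfold xRe
    have : (b j).re ≤ |(b j).re| * c := by
      calc (b j).re ≤ |(b j).re| := le_abs_self _
        _ = |(b j).re| * 1 := (mul_one _).symm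
        _ ≤ |(b j).re| * c := mul_le_mul_of_nonneg_left hc1 (abs_nonneg _)
    nlinarith
  -- the `j₀` pieces
  set x₀ := xRe a b c j₀ with hx₀
  have hx₀2 : 2 ≤ x₀ := hx2 j₀
  have hbre : (b j₀).re ≤ |(b j₀).re| * c := by
    calc (b j₀).re ≤ |(b j₀).re| := le_abs_self _
      _ = |(b j₀).re| * 1 := (mul_one _).symm
      _ ≤ |(b j₀).re| * c := mul_le_mul_of_nonneg_left hc1 (abs_nonneg _)
  have hx₀def : x₀ = a j₀ * c + (b j₀).re := rfl
  have t1 : (x₀ + 1) * Real.log (x₀ + 1) ≤ bCoef (a j₀ + |(b j₀).re| + 1) * L :=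
    mul_log_le hc3 (by linarith) (by rw [hx₀def]; nlinarith)
  have t2 : 6 * x₀ + 5 ≤ (6 * a j₀ + |6 * (b j₀).re + 5|) * L := by
    have := lin_le (β := 6 * (b j₀).re + 5) hc3 (show 0 ≤ 6 * a j₀ by have := ha j₀; positivity)
    rw [hx₀def]; linarith
  have t3 : (2 * x₀ + 2) * Real.log (2 * x₀ + 2) ≤ bCoef (2 * a j₀ + 2 * |(b j₀).re| + 2) * L :=
    mul_log_le hc3 (by linarith) (by rw [hx₀def]; nlinarith)
  have t4 : (3 * x₀ + 5) * Real.log (3 * x₀ + 5) ≤ bCoef (3 * a j₀ + 3 * |(b j₀).re| + 5) * L :=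
    mul_log_le hc3 (by linarith) (by rw [hx₀def]; nlinarith)
  have t5 : Real.log (2 / a j₀) ≤ |Real.log (2 / a j₀)| * L := by
    calc Real.log (2 / a j₀) ≤ |Real.log (2 / a j₀)| := le_abs_self _
      _ = |Real.log (2 / a j₀)| * 1 := (mul_one _).symm
      _ ≤ |Real.log (2 / a j₀)| * L := mul_le_mul_of_nonneg_left (by linarith) (abs_nonneg _)
  have hmaj := log_majIntegral_le hx₀2
  -- assemble
  have hprod0 : 0 < ∏ j ∈ Finset.univ.erase j₀, Real.Gamma (xRe a b c j) :=
    Finset.prod_pos fun j _ ↦ Real.Gamma_pos_of_pos (hx0 j)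
  have hM0 : 0 < majIntegral x₀ := majIntegral_pos (hx0 j₀)
  unfold bigM
  rw [Real.log_mul hprod0.ne' (by have := ha j₀; positivity),
    Real.log_mul (by have := ha j₀; positivity) hM0.ne', Real.log_prod (fun j _ ↦ (Real.Gamma_pos_of_pos (hx0 j)).ne')]
  have hsum : ∑ j ∈ Finset.univ.erase j₀, Real.log (Real.Gamma (xRe a b c j)) ≤
      (∑ j ∈ Finset.univ.erase j₀, bCoef (a j + |(b j).re| + 1)) * L := by
    rw [Finset.sum_mul]
    exact Finset.sum_le_sum fun j _ ↦ hΓj j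
  unfold aCoef
  nlinarith

/-- **Growth, exponential form**: `M(c) ≤ exp(A c log c)` for `c ≥ c₀`. [cite: Dobner2021, Lemma 2 (proof, pp. 15–16)] -/
theorem bigM_le_exp (ha : ∀ j, 0 < a j) (hb : ∀ j, 0 ≤ (b j).re) (j₀ : Fin k) {c : ℝ}
    (hc : cZero a ≤ c) :
    bigM (a := a) (b := b) j₀ c ≤ Real.exp (aCoef a b j₀ * (c * Real.log c)) := by
  have hc0 : 0 < c := by linarith [(three_le_cZero ha).trans hc]
  have h := log_bigM_le ha hb j₀ hc
  have hpos := bigM_pos ha hb j₀ hc0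
  calc bigM j₀ c = Real.exp (Real.log (bigM j₀ c)) := (Real.exp_log hpos).symm
    _ ≤ _ := Real.exp_le_exp.2 h

end Product


/-! ### The shift of the line of integration `Re w = 1 → Re w = c` -/

section Shift

variable {k : ℕ} {a : Fin k → ℝ} {b : Fin k → ℂ}

/-- `Ψ` is holomorphic on `Re w > 0` (no poles of `Γ(aⱼ w + bⱼ)` there). [cite: Dobner2021, Lemma 2 (proof, pp. 15–16)] -/
theorem differentiableAt_Psi (ha : ∀ j, 0 < a j) (hb : ∀ j, 0 ≤ (b j).re) {w : ℂ}
    (hw : 0 < w.re) : DifferentiableAt ℂ (Psi a b) w := by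
  unfold Psi
  refine DifferentiableAt.fun_finsetProd fun j _ ↦ ?_
  refine (Complex.differentiableAt_Gamma _ fun m h ↦ ?_).comp w (by fun_prop)
  have := congrArg Complex.re h
  simp only [Complex.add_re, Complex.mul_re, Complex.ofReal_re, Complex.ofReal_im, zero_mul,
    sub_zero, Complex.neg_re, Complex.natCast_re] at this
  have h1 : 0 < a j * w.re := mul_pos (ha j) hw
  linarith [hb j, m.cast_nonneg (α := ℝ)]

/-- The integrand `F(w) = r^{−w} Ψ(w)`. [folklore] -/
def integrand (a : Fin k → ℝ) (b : Fin k → ℂ) (r : ℝ) (w : ℂ) : ℂ := (r : ℂ) ^ (-w) * Psi a b w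

/-- `F = r^{−w} Ψ` is holomorphic on `Re w > 0`. [cite: Dobner2021, Lemma 2 (proof, pp. 15–16)] -/
theorem differentiableAt_integrand (ha : ∀ j, 0 < a j) (hb : ∀ j, 0 ≤ (b j).re) {r : ℝ} (hr : 0 < r)
    {w : ℂ} (hw : 0 < w.re) : DifferentiableAt ℂ (integrand a b r) w := by
  unfold integrand
  refine DifferentiableAt.mul ?_ (differentiableAt_Psi ha hb hw)
  exact differentiableAt_id.neg.const_cpow (Or.inl (by exact_mod_cast hr.ne'))

/-- `y ↦ F(σ + iy)` is continuous (`σ > 0`). [folklore] -/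
private theorem continuous_integrand_vertical (ha : ∀ j, 0 < a j) (hb : ∀ j, 0 ≤ (b j).re) {r : ℝ}
    (hr : 0 < r) {σ : ℝ} (hσ : 0 < σ) :
    Continuous fun y : ℝ ↦ integrand a b r ((σ : ℂ) + y * I) := by
  refine continuous_iff_continuousAt.2 fun y ↦ ?_
  have h : DifferentiableAt ℂ (integrand a b r) ((σ : ℂ) + y * I) :=
    differentiableAt_integrand ha hb hr (by simpa using hσ)
  exact h.continuousAt.comp (f := fun y : ℝ ↦ (σ : ℂ) + y * I) (by fun_prop)

/-- `‖F(σ + iy)‖ = r^{−σ} ‖Ψ(σ + iy)‖`. [folklore] -/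
private theorem norm_integrand (r : ℝ) (hr : 0 < r) (σ y : ℝ) :
    ‖integrand a b r ((σ : ℂ) + y * I)‖ = r ^ (-σ) * ‖Psi a b ((σ : ℂ) + y * I)‖ := by
  unfold integrand
  rw [norm_mul, Complex.norm_cpow_eq_rpow_re_of_pos hr]
  simp

/-- `y ↦ F(σ + iy)` is integrable (`σ > 0`), dominated by `r^{−σ} · bigMaj`. [cite: Dobner2021, Lemma 2 (proof, pp. 15–16)] -/
theorem integrable_integrand_vertical (ha : ∀ j, 0 < a j) (hb : ∀ j, 0 ≤ (b j).re) (j₀ : Fin k)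
    {r : ℝ} (hr : 0 < r) {σ : ℝ} (hσ : 0 < σ) :
    Integrable fun y : ℝ ↦ integrand a b r ((σ : ℂ) + y * I) := by
  refine Integrable.mono' ((integrable_bigMaj ha hb j₀ hσ).const_mul (r ^ (-σ)))
    (continuous_integrand_vertical ha hb hr hσ).aestronglyMeasurable (ae_of_all _ fun y ↦ ?_)
  rw [norm_integrand r hr]
  exact mul_le_mul_of_nonneg_left (norm_Psi_le ha hb j₀ hσ y) (Real.rpow_nonneg hr.le _)

/-- Uniform horizontal decay of `Ψ` on `1 ≤ Re w ≤ c`. [cite: Dobner2021, Lemma 2 (proof, pp. 15–16)] -/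
theorem decay_Psi (ha : ∀ j, 0 < a j) (hb : ∀ j, 0 ≤ (b j).re) (j₀ : Fin k) {c : ℝ} (hc : 1 ≤ c) :
    ∀ ε : ℝ, 0 < ε → ∃ T₀ : ℝ, ∀ T : ℝ, T₀ ≤ |T| → ∀ σ ∈ Icc 1 c,
      ‖Psi a b ((σ : ℂ) + T * I)‖ ≤ ε := by
  intro ε hε
  -- bounds for `Γ(xⱼ(σ))`, `σ ∈ [1, c]`
  have hx1 : ∀ j, 0 < xRe a b 1 j := xRe_pos ha hb one_pos
  have hmono : ∀ j, ∀ σ ∈ Icc 1 c, xRe a b σ j ∈ Icc (xRe a b 1 j) (xRe a b c j) := by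
    intro j σ hσ
    unfold xRe
    constructor <;> nlinarith [ha j, hσ.1, hσ.2]
  have hB : ∀ j, ∃ B : ℝ, ∀ u ∈ Icc (xRe a b 1 j) (xRe a b c j), ‖Real.Gamma u‖ ≤ B := by
    intro j
    refine isCompact_Icc.exists_bound_of_continuousOn fun u hu ↦ ?_
    refine (Real.differentiableAt_Gamma fun m h ↦ ?_).continuousAt.continuousWithinAt
    have : 0 < u := lt_of_lt_of_le (hx1 j) hu.1
    rw [h] at this
    have := m.cast_nonneg (α := ℝ)
    linarith
  choose B hB using hB
  have hB0 : ∀ j, 0 ≤ B j := fun j ↦ (norm_nonneg _).trans (hB j _ ⟨le_rfl, (hmono j 1 ⟨le_rfl, hc⟩).2⟩)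
  have hΓle : ∀ j, ∀ σ ∈ Icc 1 c, Real.Gamma (xRe a b σ j) ≤ B j := fun j σ hσ ↦
    (le_abs_self _).trans ((Real.norm_eq_abs _).symm.le.trans (hB j _ (hmono j σ hσ)))
  -- the `j₀` factor: a majorant uniform in `σ`, valid for `t ≥ 1`
  set u₂ : ℝ := xRe a b c j₀ with hu₂
  have hu₂0 : 0 < u₂ := lt_of_lt_of_le (hx1 j₀) (hmono j₀ c ⟨hc, le_rfl⟩).1
  set mt : ℝ → ℝ := fun t ↦ (B j₀ * Real.exp (Real.pi / 2) + kConst u₂ * t ^ pExp u₂) *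
    Real.exp (-(Real.pi / 2 * t)) with hmt
  have hmaj_le : ∀ σ ∈ Icc 1 c, ∀ t : ℝ, 1 ≤ t → maj (xRe a b σ j₀) t ≤ mt t := by
    intro σ hσ t ht
    set x := xRe a b σ j₀ with hx
    have hxI := hmono j₀ σ hσ
    have hx0 : 0 < x := lt_of_lt_of_le (hx1 j₀) hxI.1
    have hxu : x ≤ u₂ := hxI.2
    have hpx : pExp x ≤ pExp u₂ := by unfold pExp; linarith
    have hpx0 : 0 ≤ pExp x := (pExp_pos hx0).le
    have hK : kConst x ≤ kConst u₂ := by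
      unfold kConst
      have h1 : Real.exp (6 * x + 5) ≤ Real.exp (6 * u₂ + 5) := Real.exp_le_exp.2 (by linarith)
      have h2 : (2 * x + 2) ^ pExp x ≤ (2 * u₂ + 2) ^ pExp u₂ :=
        calc (2 * x + 2) ^ pExp x ≤ (2 * u₂ + 2) ^ pExp x :=
              Real.rpow_le_rpow (by linarith) (by linarith) hpx0
          _ ≤ (2 * u₂ + 2) ^ pExp u₂ := Real.rpow_le_rpow_of_exponent_le (by linarith) hpx
      have h3 : 0 ≤ (2 * x + 2) ^ pExp x := Real.rpow_nonneg (by linarith) _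
      exact mul_le_mul h1 h2 h3 (Real.exp_pos _).le
    have ht : t ^ pExp x ≤ t ^ pExp u₂ := Real.rpow_le_rpow_of_exponent_le ht hpx
    have hΓ : Real.Gamma x ≤ B j₀ := hΓle j₀ σ hσ
    simp only [hmt, maj]
    apply mul_le_mul_of_nonneg_right _ (Real.exp_pos _).le
    have e1 : Real.Gamma x * Real.exp (Real.pi / 2) ≤ B j₀ * Real.exp (Real.pi / 2) :=
      mul_le_mul_of_nonneg_right hΓ (Real.exp_pos _).le
    have e2 : kConst x * t ^ pExp x ≤ kConst u₂ * t ^ pExp u₂ :=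
      mul_le_mul hK ht (Real.rpow_nonneg (by linarith) _) (kConst_pos hu₂0).le
    linarith
  -- `mt → 0`
  have hmt0 : Tendsto mt atTop (nhds 0) := by
    have h1 := tendsto_rpow_mul_exp_neg_mul_atTop_nhds_zero 0 (Real.pi / 2) (by positivity)
    have h2 := tendsto_rpow_mul_exp_neg_mul_atTop_nhds_zero (pExp u₂) (Real.pi / 2) (by positivity)
    have h := (h1.const_mul (B j₀ * Real.exp (Real.pi / 2))).add (h2.const_mul (kConst u₂))
    rw [mul_zero, mul_zero, add_zero] at h
    refine h.congr' ?_
    filter_upwards [eventually_gt_atTop 0] with t ht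
    simp only [hmt, Real.rpow_zero, one_mul, neg_mul]
    ring
  -- choose `T₁` with `P · mt t ≤ ε` for `t ≥ T₁`
  set P : ℝ := ∏ j ∈ Finset.univ.erase j₀, B j with hP
  have hP0 : 0 ≤ P := Finset.prod_nonneg fun j _ ↦ hB0 j
  have hev : ∀ᶠ t in atTop, (P + 1) * mt t < ε := by
    have := (hmt0.const_mul (P + 1))
    rw [mul_zero] at this
    exact this.eventually (gt_mem_nhds hε)
  obtain ⟨T₁, hT₁⟩ := Filter.eventually_atTop.1 (hev.and (eventually_ge_atTop 1))
  refine ⟨(max T₁ 1 + |(b j₀).im|) / a j₀, fun T hT σ hσ ↦ ?_⟩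
  have hσ0 : 0 < σ := by linarith [hσ.1]
  set t : ℝ := |a j₀ * T + (b j₀).im| with ht
  have ht1 : max T₁ 1 ≤ t := by
    have h1 : max T₁ 1 + |(b j₀).im| ≤ a j₀ * |T| := by
      have := (div_le_iff₀ (ha j₀)).1 hT; linarith
    have h2 : |a j₀ * T| - |(b j₀).im| ≤ |a j₀ * T + (b j₀).im| := by
      have := abs_add_le (a j₀ * T + (b j₀).im) (-(b j₀).im)
      simp only [add_neg_cancel_right, abs_neg] at this
      linarith
    rw [abs_mul, abs_of_pos (ha j₀)] at h2
    linarith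
  obtain ⟨hε', ht1'⟩ := hT₁ t (le_trans (le_max_left _ _) ht1)
  have hmt_nonneg : 0 ≤ mt t := by
    simp only [hmt]
    have := hB0 j₀
    have := kConst_pos hu₂0
    have : 0 ≤ t ^ pExp u₂ := Real.rpow_nonneg (abs_nonneg _) _
    positivity
  calc ‖Psi a b ((σ : ℂ) + T * I)‖ ≤ bigMaj (a := a) (b := b) j₀ σ T := norm_Psi_le ha hb j₀ hσ0 T
    _ ≤ P * mt t := by
        unfold bigMaj
        apply mul_le_mul _ (hmaj_le σ hσ t ht1') (maj_nonneg (xRe_pos ha hb hσ0 j₀) (abs_nonneg _)) hP0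
        exact Finset.prod_le_prod (fun j _ ↦ (Real.Gamma_pos_of_pos (xRe_pos ha hb hσ0 j)).le)
          fun j _ ↦ hΓle j σ hσ
    _ ≤ (P + 1) * mt t := by nlinarith
    _ ≤ ε := hε'.le

/-- **The contour shift**: `mellinInv 1 Ψ r = mellinInv c Ψ r` for `r ≥ 1`, `c ≥ 1`. [cite: Dobner2021, Lemma 2 (proof, pp. 15–16)] -/
theorem mellinInv_eq (ha : ∀ j, 0 < a j) (hb : ∀ j, 0 ≤ (b j).re) (j₀ : Fin k) {r : ℝ} (hr : 1 ≤ r)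
    {c : ℝ} (hc : 1 ≤ c) : mellinInv 1 (Psi a b) r = mellinInv c (Psi a b) r := by
  have hr0 : 0 < r := by linarith
  unfold mellinInv
  congr 1
  have key := Literature.Analysis.Complex.integral_vertical_eq_of_differentiableOn
    (F := integrand a b r) (a := 1) (b := c) hc ?_ ?_ ?_ ?_
  · simpa [integrand, smul_eq_mul] using key
  · intro w hw
    exact (differentiableAt_integrand ha hb hr0 (by
      have : (1 : ℝ) ≤ w.re := hw.1; linarith)).differentiableWithinAt
  · simpa using integrable_integrand_vertical ha hb j₀ hr0 (σ := 1) one_pos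
  · exact integrable_integrand_vertical ha hb j₀ hr0 (by linarith)
  · intro ε hε
    obtain ⟨T₀, hT₀⟩ := decay_Psi ha hb j₀ hc ε hε
    refine ⟨T₀, fun T hT σ hσ ↦ ?_⟩
    rw [norm_integrand r hr0]
    have h1 : r ^ (-σ) ≤ 1 := Real.rpow_le_one_of_one_le_of_nonpos hr (by linarith [hσ.1])
    have h2 := hT₀ T hT σ hσ
    calc r ^ (-σ) * ‖Psi a b ((σ : ℂ) + T * I)‖ ≤ 1 * ε :=
          mul_le_mul h1 h2 (norm_nonneg _) zero_le_one
      _ = ε := one_mul ε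

end Shift


section Final

variable {k : ℕ} {a : Fin k → ℝ} {b : Fin k → ℂ}

/-- The bound on the shifted integral: `‖mellinInv c Ψ r‖ ≤ r^{−c} M(c)`. [cite: Dobner2021, Lemma 2 (proof, pp. 15–16)] -/
theorem norm_mellinInv_le (ha : ∀ j, 0 < a j) (hb : ∀ j, 0 ≤ (b j).re) (j₀ : Fin k) {r : ℝ}
    (hr : 0 < r) {c : ℝ} (hc : 0 < c) :
    ‖mellinInv c (Psi a b) r‖ ≤ r ^ (-c) * bigM (a := a) (b := b) j₀ c := by
  unfold mellinInv
  have hint : Integrable fun y : ℝ ↦ integrand a b r ((c : ℂ) + y * I) :=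
    integrable_integrand_vertical ha hb j₀ hr hc
  have heq : (fun y : ℝ ↦ (r : ℂ) ^ (-((c : ℂ) + y * I)) • Psi a b ((c : ℂ) + y * I)) =
      fun y : ℝ ↦ integrand a b r ((c : ℂ) + y * I) := by
    funext y; rw [smul_eq_mul]; rfl
  rw [heq, norm_smul]
  have hπ : ‖(1 / (2 * Real.pi) : ℝ)‖ ≤ 1 := by
    rw [Real.norm_eq_abs, abs_of_pos (by positivity)]
    rw [div_le_one (by positivity)]; linarith [Real.pi_gt_three]
  have hI : ‖∫ y : ℝ, integrand a b r ((c : ℂ) + y * I)‖ ≤ r ^ (-c) * bigM (a := a) (b := b) j₀ c := by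
    refine (norm_integral_le_integral_norm _).trans ?_
    rw [← integral_bigMaj ha hb j₀ hc, ← integral_const_mul]
    refine integral_mono hint.norm ((integrable_bigMaj ha hb j₀ hc).const_mul _) fun y ↦ ?_
    simp only
    rw [norm_integrand r hr]
    exact mul_le_mul_of_nonneg_left (norm_Psi_le ha hb j₀ hc y) (Real.rpow_nonneg hr.le _)
  have h0 : 0 ≤ r ^ (-c) * bigM (a := a) (b := b) j₀ c :=
    mul_nonneg (Real.rpow_nonneg hr.le _) (bigM_pos ha hb j₀ hc).le
  calc ‖(1 / (2 * Real.pi) : ℝ)‖ * ‖∫ y : ℝ, integrand a b r ((c : ℂ) + y * I)‖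
      ≤ 1 * (r ^ (-c) * bigM (a := a) (b := b) j₀ c) := mul_le_mul hπ hI (norm_nonneg _) zero_le_one
    _ = _ := one_mul _

end Final

end DobnerLemma2

open DobnerLemma2 in
/-- **Discharge of `dobner_lemma2`** (Dobner 2021, Lemma 2): for `aⱼ > 0`, `Re bⱼ ≥ 0`, `k ≥ 1`,
the inverse Mellin transform `h(x) = (1/2πi)∫_{(1)} ∏Γ(aⱼw + bⱼ) x^{−w} dw` satisfies
`|h(x)| ≤ C e^{−x^δ}` for `x ≥ 1`, some `δ > 0`. PROOF ROUTE (divergence from the printed proof,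
statement unchanged): the source argues through the class `𝓡` and the Mellin convolution
theorem (not available in Mathlib); here we shift the line of integration to `Re w = c`
(`Literature.Analysis.Complex.integral_vertical_eq_of_differentiableOn`; no poles on `Re w > 0`),
bound `∫|∏Γ(aⱼ(c+iy)+bⱼ)| dy ≤ exp(A c log c)` by Stirling (the majorant of
`DobnerLemma1.abs_log_norm_Gamma_add_le` for one factor, `|Γ(x+iy)| ≤ Γ(x)` for the others), and
take `c = x^δ` with `δ = 1/(2A)`, so that `|h(x)| ≤ x^{−c} e^{A c log c} = e^{−½ x^δ log x}`.
[cite: Dobner2021, Lemma 2] -/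
theorem dobner_lemma2_holds : dobner_lemma2 := by
  intro k a b hk ha hb
  set j₀ : Fin k := ⟨0, hk⟩ with hj₀
  -- constants
  set A : ℝ := max (aCoef a b j₀) 1 with hA
  have hA1 : 1 ≤ A := le_max_right _ _
  have hA0 : 0 < A := by linarith
  have hAc : aCoef a b j₀ ≤ A := le_max_left _ _
  set c₀ : ℝ := cZero a with hc₀
  have hc₀3 : 3 ≤ c₀ := three_le_cZero ha
  have hlogc₀ : 1 ≤ Real.log c₀ := one_le_log_three_le hc₀3
  set δ : ℝ := 1 / (2 * A) with hδ
  have hδ0 : 0 < δ := by positivity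
  have hAδ : A * δ = 1 / 2 := by rw [hδ]; field_simp
  set C : ℝ := Real.exp (A * (c₀ * Real.log c₀) + c₀) with hC
  have hC1 : 1 ≤ C := Real.one_le_exp (by positivity)
  refine ⟨δ, C, hδ0, fun r hr ↦ ?_⟩
  have hr0 : 0 < r := by linarith
  set c : ℝ := max c₀ (r ^ δ) with hc
  have hcc₀ : c₀ ≤ c := le_max_left _ _
  have hc3 : 3 ≤ c := hc₀3.trans hcc₀
  have hc0 : 0 < c := by linarith
  have hΨ : (fun w : ℂ ↦ ∏ j, Complex.Gamma ((a j : ℂ) * w + b j)) = Psi a b := rfl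
  rw [hΨ, mellinInv_eq ha hb j₀ hr (by linarith : (1 : ℝ) ≤ c)]
  have h1 := norm_mellinInv_le ha hb j₀ hr0 hc0
  have h2 : bigM (a := a) (b := b) j₀ c ≤ Real.exp (A * (c * Real.log c)) :=
    (bigM_le_exp ha hb j₀ hcc₀).trans (Real.exp_le_exp.2
      (mul_le_mul_of_nonneg_right hAc (by nlinarith [one_le_log_three_le hc3])))
  have hrc0 : 0 ≤ r ^ (-c) := Real.rpow_nonneg hr0.le _
  have h3 : ‖mellinInv c (Psi a b) r‖ ≤ r ^ (-c) * Real.exp (A * (c * Real.log c)) :=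
    h1.trans (mul_le_mul_of_nonneg_left h2 hrc0)
  refine h3.trans ?_
  rcases le_or_gt (r ^ δ) c₀ with hsmall | hlarge
  · -- `c = c₀`
    have hcc : c = c₀ := max_eq_left hsmall
    rw [hcc]
    have h4 : r ^ (-c₀) ≤ 1 := Real.rpow_le_one_of_one_le_of_nonpos hr (by linarith)
    have h5 : Real.exp (A * (c₀ * Real.log c₀)) = C * Real.exp (-c₀) := by
      rw [hC, ← Real.exp_add]; congr 1; ring
    calc r ^ (-c₀) * Real.exp (A * (c₀ * Real.log c₀)) ≤ 1 * Real.exp (A * (c₀ * Real.log c₀)) :=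
          mul_le_mul_of_nonneg_right h4 (Real.exp_pos _).le
      _ = C * Real.exp (-c₀) := by rw [one_mul, h5]
      _ ≤ C * Real.exp (-r ^ δ) := by
          apply mul_le_mul_of_nonneg_left _ (by linarith)
          exact Real.exp_le_exp.2 (by linarith)
  · -- `c = r^δ`
    have hcc : c = r ^ δ := max_eq_right hlarge.le
    have hlogc : Real.log c = δ * Real.log r := by rw [hcc, Real.log_rpow hr0]
    have hlogc1 : 1 ≤ Real.log c := one_le_log_three_le hc3
    have hlogr : 2 ≤ Real.log r := by
      have h6 : 1 ≤ δ * Real.log r := hlogc ▸ hlogc1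
      have h7 : δ * (2 * A) = 1 := by rw [hδ]; field_simp
      nlinarith
    have hexp : r ^ (-c) * Real.exp (A * (c * Real.log c)) = Real.exp (-(1 / 2) * c * Real.log r) := by
      rw [Real.rpow_def_of_pos hr0, ← Real.exp_add, hlogc]
      congr 1
      have : A * (c * (δ * Real.log r)) = (A * δ) * c * Real.log r := by ring
      rw [this, hAδ]; ring
    rw [hexp, ← hcc]
    calc Real.exp (-(1 / 2) * c * Real.log r) ≤ Real.exp (-c) := Real.exp_le_exp.2 (by nlinarith)
      _ = 1 * Real.exp (-c) := (one_mul _).symm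
      _ ≤ C * Real.exp (-c) := mul_le_mul_of_nonneg_right hC1 (Real.exp_pos _).le

end Literature.NumberTheory.LFunctions

end
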